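import Literature.NumberTheory.Irrationality.BrownZudilin2022.DescentToZetaThree
import Literature.NumberTheory.Irrationality.RhinViola2001.GroupStructure
import HarnessLib

/-!
# The generalised Beukers integral `J₃` of Brown–Zudilin's descent (22) IS Rhin–Viola's `I(h,j,k,l,m,q,r,s)`
(cell `pub-zeta5`, seat ct-1 g46)

HONEST FRAMING: systematic search; no irrationality claim unless certified.  An identity between two real triple
integrals already in the tree; nothing here concerns the arithmetic nature of `ζ(5)` or `ζ(3)`; records in print
UNMOVED; nothing is discharged (net named-fact debt 0).  Theorems only (0 `def`).

OUR work (Summit side).  Brown–Zudilin's companion integrals of the descent (22) [BrownZudilin2022, Sect. 6, (23)]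
`J₃(p₀,p₁,p₂,p₃;q₁,q₂,q₃) = ∫_{[0,1]³} y₁^{p₁}(1−y₁)^{q₁}y₂^{p₂}(1−y₂)^{q₂}y₃^{p₃}(1−y₃)^{q₃}/(1−y₃(1−y₁y₂))^{p₀+1} dy`
are typed (`BrownZudilin2022.J3`) through Zudilin's Sorokin-type integral `Zudilin2002.sorokinIntegral 3` over the CLOSED
cube with real powers, in the variables `(x₁,x₂,x₃) = (y₃,y₁,1−y₂)`.  Rhin–Viola's `I(h,j,k,l,m,q,r,s)` [RhinViola2001, (2.1)]
(`RhinViola2001.I`: the OPEN cube, integer powers) has the integrand `x^h(1−x)^l y^k(1−y)^s z^j(1−z)^q/(1−(1−xy)z)^{q+h−r+1}`.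
Reading `(x,y,z) = (y₁,y₂,y₃)`:

* `balanced_iff`, `nonneg_of_provisos` — the Rhin–Viola parameters
  `(h,j,k,l,m,q,r,s) = (p₁, p₃, p₂, q₁, p₂+q₃−p₀, q₃, p₁+q₃−p₀, q₂)` (`r` from the exponent `q+h−r+1 = p₀+1`, `m = k+r−h`)
  satisfy (2.2)–(2.3) exactly when Brown–Zudilin's (24) `p₃+q₃ = q₁+q₂` holds, and are `≥ 0` under the provisos of (22);
* `sorokinIntegrand_three_substitute` — the `J₃` integrand at the point `(x₂, x₀, 1−x₁)` is Rhin–Viola's integrand at `x`;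
* `setIntegral_closedCube_eq_cube` — closed and open cube carry the same integrals (`Measure.univ_pi_Ioo_ae_eq_Icc`);
* **`J3_eq_rhinViolaI`** — for ALL integers `p₀,…,q₃`:
  `J₃(p₀,p₁,p₂,p₃;q₁,q₂,q₃) = I(p₁, p₃, p₂, q₁, p₂+q₃−p₀, q₃, p₁+q₃−p₀, q₂)`,
  by the measure-preserving change of variables `x ↦ (x₂, x₀, 1−x₁)` of `ℝ³` (a coordinate permutation,
  `volume_measurePreserving_piCongrLeft`, followed by the reflection `t ↦ 1−t` in one coordinate, `measurePreserving_pi` with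
  `Measure.measurePreserving_sub_left`), which maps the open cube onto itself.
-/

noncomputable section

open MeasureTheory Set

namespace Summit.KontsevichZagierPeriods.Zeta5Search.DescentJ3RhinViola

open Literature.NumberTheory.Irrationality
open Literature.NumberTheory.Irrationality.BrownZudilin2022 (J3)
open Literature.NumberTheory.Irrationality.RhinViola2001 (Params integrand I cube)

/-! ### The Rhin–Viola parameters of `J₃(p₀,p₁,p₂,p₃;q₁,q₂,q₃)` -/

/-- Rhin–Viola's balance conditions (2.2)–(2.3) for `(p₁, p₃, p₂, q₁, p₂+q₃−p₀, q₃, p₁+q₃−p₀, q₂)` ARE Brown–Zudilin's (24)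
`p₃ + q₃ = q₁ + q₂` ((2.2) `h+m = k+r` holds identically). -/
theorem balanced_iff (p₀ p₁ p₂ p₃ q₁ q₂ q₃ : ℤ) :
    (⟨p₁, p₃, p₂, q₁, p₂ + q₃ - p₀, q₃, p₁ + q₃ - p₀, q₂⟩ : Params).Balanced ↔ p₃ + q₃ = q₁ + q₂ := by
  refine ⟨fun ⟨_, h⟩ => by simpa using h, fun h24 => ⟨?_, ?_⟩⟩
  · show p₁ + (p₂ + q₃ - p₀) = p₂ + (p₁ + q₃ - p₀); ring
  · show p₃ + q₃ = q₁ + q₂; exact h24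

/-- Under the provisos of (22) (non-negative parameters, `p₀ ≤ p₁ + q₃`, `p₀ ≤ p₂ + q₃`) the Rhin–Viola parameters are
non-negative. -/
theorem nonneg_of_provisos {p₀ p₁ p₂ p₃ q₁ q₂ q₃ : ℤ} (h1 : 0 ≤ p₁) (h2 : 0 ≤ p₂) (h3 : 0 ≤ p₃) (g1 : 0 ≤ q₁)
    (g2 : 0 ≤ q₂) (g3 : 0 ≤ q₃) (c1 : p₀ ≤ p₁ + q₃) (c2 : p₀ ≤ p₂ + q₃) :
    (⟨p₁, p₃, p₂, q₁, p₂ + q₃ - p₀, q₃, p₁ + q₃ - p₀, q₂⟩ : Params).Nonneg := by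
  refine ⟨h1, h3, h2, g1, ?_, g3, ?_, g2⟩
  · show (0 : ℤ) ≤ p₂ + q₃ - p₀; omega
  · show (0 : ℤ) ≤ p₁ + q₃ - p₀; omega

/-! ### The two integrands -/

/-- `t^{(a+1)−1} = t^a` (real power with an integer exponent). -/
theorem rpow_aux₁ (t : ℝ) (a : ℤ) : t ^ ((a : ℝ) + 1 - 1) = t ^ a := by
  rw [add_sub_cancel_right, Real.rpow_intCast]

/-- `t^{(a+b+2)−(a+1)−1} = t^b`. -/
theorem rpow_aux₂ (t : ℝ) (a b : ℤ) : t ^ ((a : ℝ) + b + 2 - ((a : ℝ) + 1) - 1) = t ^ b := by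
  rw [show (a : ℝ) + b + 2 - ((a : ℝ) + 1) - 1 = ((b : ℤ) : ℝ) by ring, Real.rpow_intCast]

/-- `t^{(a+b+2)−(b+1)−1} = t^a`. -/
theorem rpow_aux₃ (t : ℝ) (a b : ℤ) : t ^ ((a : ℝ) + b + 2 - ((b : ℝ) + 1) - 1) = t ^ a := by
  rw [show (a : ℝ) + b + 2 - ((b : ℝ) + 1) - 1 = ((a : ℤ) : ℝ) by ring, Real.rpow_intCast]

/-- `t^{a+1}` as an integer power. -/
theorem rpow_aux₄ (t : ℝ) (a : ℤ) : t ^ ((a : ℝ) + 1) = t ^ (a + 1) := by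
  rw [show (a : ℝ) + 1 = ((a + 1 : ℤ) : ℝ) by push_cast; ring, Real.rpow_intCast]

/-- **The substitution**: the `J₃` integrand (Zudilin's `sorokinIntegrand 3` at the parameters of `BrownZudilin2022.J3`),
taken at the point `(x₂, x₀, 1 − x₁)`, is Rhin–Viola's integrand at `x = (x₀,x₁,x₂)`. -/
theorem sorokinIntegrand_three_substitute (p₀ p₁ p₂ p₃ q₁ q₂ q₃ : ℤ) (x : Fin 3 → ℝ) :
    Zudilin2002.sorokinIntegrand 3 ((p₀ : ℝ) + 1)
        (fun i => if i = 0 then (p₃ : ℝ) + 1 else if i = 1 then (p₁ : ℝ) + 1 else (q₂ : ℝ) + 1)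
        (fun i => if i = 0 then (p₃ : ℝ) + q₃ + 2 else if i = 1 then (p₁ : ℝ) + q₁ + 2 else (p₂ : ℝ) + q₂ + 2)
        ![x 2, x 0, 1 - x 1] =
      integrand ⟨p₁, p₃, p₂, q₁, p₂ + q₃ - p₀, q₃, p₁ + q₃ - p₀, q₂⟩ x := by
  simp only [Zudilin2002.sorokinIntegrand, Fin.prod_univ_three, Fin.isValue, Fin.val_zero, Fin.val_one,
    Fin.val_two, List.ofFn_succ, List.ofFn_zero, Zudilin2002.nestedQ, Fin.succ_zero_eq_one, Fin.succ_one_eq_two,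
    Matrix.cons_val_zero, Matrix.cons_val_one, Matrix.cons_val_two, Matrix.head_cons, Matrix.tail_cons, integrand]
  norm_num only []
  simp only [ite_true, ite_false, rpow_aux₁, rpow_aux₂, rpow_aux₃, rpow_aux₄, sub_sub_cancel]
  have hexp : q₃ + p₁ - (p₁ + q₃ - p₀) + 1 = p₀ + 1 := by ring
  have hQ : (1 : ℝ) - x 2 * (1 - x 0 * (1 - (1 - x 1) * 1)) = 1 - (1 - x 0 * x 1) * x 2 := by ring
  rw [hexp, hQ]
  ring

/-! ### The identity -/

/-- Membership in Rhin–Viola's open cube, coordinate by coordinate. -/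
theorem mem_cube_iff (x : Fin 3 → ℝ) :
    x ∈ cube ↔ (0 < x 0 ∧ x 0 < 1) ∧ (0 < x 1 ∧ x 1 < 1) ∧ (0 < x 2 ∧ x 2 < 1) := by
  simp only [cube, mem_setOf_eq, mem_Ioo, Fin.forall_fin_succ, Fin.succ_zero_eq_one, Fin.succ_one_eq_two,
    IsEmpty.forall_iff, and_true]

/-- The open cube is measurable. -/
theorem measurableSet_cube : MeasurableSet cube := by
  have hcube : cube = Set.pi Set.univ (fun _ : Fin 3 => Ioo (0 : ℝ) 1) := by
    ext x; simp [cube]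
  rw [hcube]
  exact MeasurableSet.univ_pi fun _ => measurableSet_Ioo

/-- The closed cube of `sorokinIntegral` and Rhin–Viola's open `cube` carry the same integrals (their difference is null). -/
theorem setIntegral_closedCube_eq_cube (f : (Fin 3 → ℝ) → ℝ) :
    ∫ x in Set.pi Set.univ (fun _ : Fin 3 => Icc (0 : ℝ) 1), f x = ∫ x in cube, f x := by
  have hcube : cube = Set.pi Set.univ (fun _ : Fin 3 => Ioo (0 : ℝ) 1) := by
    ext x; simp [cube]
  have hIcc : (Set.pi Set.univ fun _ : Fin 3 => Icc (0 : ℝ) 1) = Icc (fun _ => (0 : ℝ)) (fun _ => 1) :=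
    Set.pi_univ_Icc (fun _ => (0 : ℝ)) (fun _ => (1 : ℝ))
  have hae : (Set.pi Set.univ fun _ : Fin 3 => Ioo (0 : ℝ) 1) =ᵐ[volume] Icc (fun _ => (0 : ℝ)) (fun _ => 1) := by
    rw [volume_pi]
    exact Measure.univ_pi_Ioo_ae_eq_Icc
  rw [hcube, hIcc]
  exact setIntegral_congr_set hae.symm

/-- **The change of variables `x ↦ (x₂, x₀, 1−x₁)` preserves Lebesgue measure on `ℝ³`, is a measurable embedding, and maps
the open cube onto itself.** -/
theorem substitution_measurePreserving :
    MeasurePreserving (fun x : Fin 3 → ℝ => ![x 2, x 0, 1 - x 1]) volume volume ∧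
      MeasurableEmbedding (fun x : Fin 3 → ℝ => ![x 2, x 0, 1 - x 1]) ∧
      (fun x : Fin 3 → ℝ => ![x 2, x 0, 1 - x 1]) ⁻¹' cube = cube := by
  -- the permutation part `x ↦ (x 2, x 0, x 1)`: `σ 0 = 2, σ 1 = 0, σ 2 = 1`
  let σ : Equiv.Perm (Fin 3) := (Equiv.swap (0 : Fin 3) 2).trans (Equiv.swap (0 : Fin 3) 1)
  have hσ0 : σ 0 = 2 := by decide
  have hσ1 : σ 1 = 0 := by decide
  have hσ2 : σ 2 = 1 := by decide
  have hperm : MeasurePreserving (fun x : Fin 3 → ℝ => fun i => x (σ i)) volume volume := by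
    have := volume_measurePreserving_piCongrLeft (fun _ : Fin 3 => ℝ) σ.symm
    convert this using 1
    funext x; funext i
    rw [MeasurableEquiv.coe_piCongrLeft, Equiv.piCongrLeft_apply_eq_cast]
    simp
  -- the reflection part in the coordinate `2`
  have hrefl : MeasurePreserving (fun x : Fin 3 → ℝ => fun i => if i = 2 then 1 - x i else x i) volume volume := by
    have := measurePreserving_pi (fun _ : Fin 3 => (volume : Measure ℝ)) (fun _ => volume)
      (f := fun i t => if i = 2 then 1 - t else t) (fun i => by
        by_cases hi : i = 2
        · simp only [hi, ite_true]; exact Measure.measurePreserving_sub_left volume (1 : ℝ)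
        · simp only [hi, ite_false]; exact MeasurePreserving.id volume)
    rwa [← volume_pi] at this
  have hT : (fun x : Fin 3 → ℝ => ![x 2, x 0, 1 - x 1]) =
      (fun x : Fin 3 → ℝ => fun i => if i = 2 then 1 - x i else x i) ∘ (fun x : Fin 3 → ℝ => fun i => x (σ i)) := by
    funext x; funext i
    fin_cases i <;> simp [hσ0, hσ1, hσ2]
  have hmp : MeasurePreserving (fun x : Fin 3 → ℝ => ![x 2, x 0, 1 - x 1]) volume volume := by
    rw [hT]; exact hrefl.comp hperm
  -- a two-sided inverse, hence a measurable equivalence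
  let e : (Fin 3 → ℝ) ≃ᵐ (Fin 3 → ℝ) :=
    { toFun := fun x => ![x 2, x 0, 1 - x 1]
      invFun := fun y => ![y 1, 1 - y 2, y 0]
      left_inv := fun x => by funext i; fin_cases i <;> simp
      right_inv := fun y => by funext i; fin_cases i <;> simp
      measurable_toFun := hmp.measurable
      measurable_invFun := by
        refine measurable_pi_iff.2 fun i => ?_
        fin_cases i
        · simpa using measurable_pi_apply 1
        · simpa using (measurable_pi_apply 2).const_sub 1
        · simpa using measurable_pi_apply 0 }
  refine ⟨hmp, e.measurableEmbedding, ?_⟩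
  ext x
  rw [mem_preimage, mem_cube_iff, mem_cube_iff]
  simp only [Matrix.cons_val_zero, Matrix.cons_val_one, Matrix.cons_val_two, Matrix.head_cons, Matrix.tail_cons]
  constructor
  · rintro ⟨h2, h0, h1⟩
    exact ⟨h0, ⟨by linarith [h1.2], by linarith [h1.1]⟩, h2⟩
  · rintro ⟨h0, h1, h2⟩
    exact ⟨h2, h0, ⟨by linarith [h1.2], by linarith [h1.1]⟩⟩

/-- **`J₃ = I`**: Brown–Zudilin's generalised Beukers integral (23) is Rhin–Viola's integral (2.1),
`J₃(p₀,p₁,p₂,p₃;q₁,q₂,q₃) = I(p₁, p₃, p₂, q₁, p₂+q₃−p₀, q₃, p₁+q₃−p₀, q₂)`, for all integer parameters (both sides are the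
same Lebesgue integral after the substitution `x ↦ (x₂,x₀,1−x₁)`; no convergence hypothesis is needed for the equality).
[BrownZudilin2022, Sect. 6, (23)]; [RhinViola2001, (2.1)]. -/
theorem J3_eq_rhinViolaI (p₀ p₁ p₂ p₃ q₁ q₂ q₃ : ℤ) :
    J3 p₀ p₁ p₂ p₃ q₁ q₂ q₃ = I ⟨p₁, p₃, p₂, q₁, p₂ + q₃ - p₀, q₃, p₁ + q₃ - p₀, q₂⟩ := by
  obtain ⟨hmp, hemb, hpre⟩ := substitution_measurePreserving
  unfold J3 Zudilin2002.sorokinIntegral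
  rw [setIntegral_closedCube_eq_cube]
  have h := hmp.setIntegral_preimage_emb hemb
    (Zudilin2002.sorokinIntegrand 3 ((p₀ : ℝ) + 1)
      (fun i => if i = 0 then (p₃ : ℝ) + 1 else if i = 1 then (p₁ : ℝ) + 1 else (q₂ : ℝ) + 1)
      (fun i => if i = 0 then (p₃ : ℝ) + q₃ + 2 else if i = 1 then (p₁ : ℝ) + q₁ + 2 else (p₂ : ℝ) + q₂ + 2)) cube
  rw [hpre] at h
  rw [← h]
  unfold I
  exact setIntegral_congr_fun measurableSet_cube fun x _ => sorokinIntegrand_three_substitute p₀ p₁ p₂ p₃ q₁ q₂ q₃ x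

end Summit.KontsevichZagierPeriods.Zeta5Search.DescentJ3RhinViola
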